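import Summits.SmoothPoincare4.SmoothPoincare4.Theses.CongruenceShadows
import Summits.SmoothPoincare4.SmoothPoincare4.Theses.GroupTrisection
import Literature.Topology.FourManifolds.TrisectionFunctorSPC4Proofs
import Literature.Topology.FourManifolds.TrisectionsProofs
import Literature.Topology.FourManifolds.HeegaardSplittingsS1S2Sums
import Literature.Topology.FourManifolds.CerfPropositionFour
import Literature.Topology.FourManifolds.SPC4HandlesTwoLeaves
import Literature.Topology.FourManifolds.SPC4HandlesNormHolds
import Literature.Topology.FourManifolds.CollarTheorem
import Literature.Topology.FourManifolds.InverseFunctionTheorem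

/-!
# Line `lp-by-minimal-heegaard-splitting` — skeleton for crux `AgkCor6Sufficiency`
# (stmt-SmoothPoincare4-10894; routes CongruenceShadows / GroupTrisection, identical decl bodies)

Idea card: `Cruxes/AgkCor6Sufficiency/Ideas/lp-by-minimal-heegaard-splitting.md` (crux-ideate r1,
ideator 1; triage r1: pass ×3).  Lever: Moussard, *On diffeomorphisms of 4-dimensional
1-handlebodies*, arXiv:2412.10210, §2 — Laudenbach–Poénaru's extension theorem (LP, the tree's
named fact `Literature.Topology.FourManifolds.exists_diffeomorph_comp_incl_eq`) from
(a) ISOTOPY-uniqueness of the minimal-genus Heegaard splitting of the double handlebody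
`∂Z ≅ #ᵏ(S¹ × S²)` (Carvalho–Oertel 2005 = Moussard Thm 2.1 / Thm 3.14, via the strong Haken
theorem Thm 3.10 after Scharlemann arXiv:2003.08523 and Hensel–Schultens arXiv:2102.09831) and
(b) the product model `Z = H ×_lens I`, foliated by handlebodies `H_t` meeting along `Σ = ∂H_t`,
on which a splitting-preserving boundary diffeomorphism extends by the formula
`(x, t) ↦ (ψ_t x, t)` once `π₀ Diff(H rel ∂H) = 0` (Moussard Lemma 2.4 ⇐ Lemma 2.3 + Smale +
Cerf's `π₀ Diff(D³ rel ∂) = 0`, the tree's leaf `cerf_pi0DiffDisc_relBoundary_three`).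
LP then feeds the rigidity leaf (b′) `diffeomorph_of_iso_groupGKTrisectionOf` of
Abrams–Gay–Kirby's Thm 5 (with Dehn–Nielsen–Baer), and the crux closes from (b′) + (c′) by the
tree's `spc4_of_forall_isStablyTrivial_of_three_leaves` with the PROVED Gay–Kirby Thm 4
`exists_isBalancedGKTrisection_holds` (the `twoLeaves` composition of the crux notes).

In-tree status used (2026-08-16): NORM `exists_hasHandleDecomposition_handleCount_one_holds`,
UNIQ₄ `nonempty_diffeomorph_of_hasHandleDecomposition_handleCount_one_holds`, the collar fact
`BoundaryData.diffeoExtends_of_isDiffeotopicToId_holds` and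
`AmbientIsotopy`/`Diffeotopy` comparison `exists_diffeotopy_of_boundaryless` are PROVED; the LP
fact's own open leaves (LEMMA2ᴹ/REALISE, THMAᴹ = Laudenbach 1973) are BYPASSED by this line.

Registered stubs (sorry only here): `stub_minimalSplittingIsotopy` (XL, hardest),
`stub_productModel` (L), `stub_laudenbachPoenaru_of` (M/L), `stub_dehnNielsenBaer` (L),
`stub_rigidity_of_lp` (XL, shared with line lp-by-sphere-system-surgery), and two DELEGATED leaf
stubs `stub_cerfDiscRelBoundary` (named fact `cerf_pi0DiffDisc_relBoundary_three`, fact seat;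
the `TwistedSpheresStandard` barrier's single leaf) and `stub_agkStabilisation` ((c′), in flight in
the tree: `TrisectionStabilization*`, `TrisectionFunctorGKStabilization*`).  Composition:
`AgkCor6Sufficiency_of` (kernel-checked, no sorry; hypotheses = the seven stub statements under their
name-keyed aliases `__Registered.stub_…`) concludes the crux BY NAME —
`Summit.SmoothPoincare4.SmoothPoincare4.Theses.GroupTrisection.AgkCor6Sufficiency` (the item's decl, the
skeleton audit's default) — and `AgkCor6Sufficiency_of_congruenceShadows` concludes the identical decl of
route `CongruenceShadows` (payload route); `agkCor6Sufficiency_proof[_congruenceShadows]` feed them the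
`stub_…` literally.

Disproof.lean (cdisprove cycle 1) honoured: it has no `_false_without_` theorem beyond
`AgkCor6SufficiencyWithoutHyp = SmoothPoincare4` (the line keeps the hypothesis `X`, consumed once,
as `hst`, inside `AgkCor6Sufficiency_of`); its tightness / refuted-strengthening lemmas
(`isStablyTrivial_tight`, `not_agkHypothesisUnbalanced`, `not_agkHypothesisAnyGroup`; landed under
`Theorems/AgkCor6Sufficiency/Negative/`) concern the numerics of `X` and are not instantiated by
any stub below (all stubs are statements of 2-, 3- and 4-manifold topology, none about kernel
triples).
-/

set_option linter.dupNamespace false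

noncomputable section

open scoped Manifold ContDiff Topology
open Set Function

namespace Summit.SmoothPoincare4.SmoothPoincare4.Cruxes.AgkCor6Sufficiency.LpByMinimalHeegaardSplitting

open Literature.Topology.FourManifolds

/-! ## The statements of the line (all over existing declarations; universe `0`, which is all the
crux needs: `spc4_of_forall_isStablyTrivial_of_three_leaves` takes the leaves at `.{0}`) -/

/-- **(S1) Minimal-genus Heegaard splittings of the double handlebody are unique up to ISOTOPY**
(Carvalho–Oertel 2005; Moussard arXiv:2412.10210 Thm 2.1, reproved as Thm 3.14 with `P = ∅` from
the sutured strong Haken theorem Thm 3.10 and Prop 3.13).  In the exact vocabulary of the tree's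
named fact `waldhausen_heegaardSplitting_sumS1S2_unique` (diffeomorphism-of-triples form, all
genera), restricted to the MINIMAL genus `g = k` (`V` has one `0`-handle and `k` `1`-handles, so
`∂V ≅ #ᵏ(S¹ × S²)`) and strengthened to isotopy: the diffeomorphism of triples `Φ` is DIFFEOTOPIC
TO THE IDENTITY of `Y`, and it carries `(H₁, H₂)` onto `(H₁', H₂')` OR onto `(H₂', H₁')` (the
isotopy classifies the Heegaard SURFACE; sides may be exchanged — e.g. `k = 1`: rotating the
`S²` factor of `S¹ × S²` by `π` swaps the two solid tori).  Sanity instances: `k = 0` is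
Alexander's theorem + the disc theorem in `S³`; `k = 1`: Gluck's three generators of
`π₀ Diff(S¹ × S²)` all preserve `S¹ × equator`. -/
def MinimalHeegaardIsotopy : Prop :=
  ∀ (V : Type) [TopologicalSpace V] [T2Space V] [SecondCountableTopology V] [CompactSpace V]
    [ConnectedSpace V] [ChartedSpace (EuclideanHalfSpace 4) V] [IsManifold (𝓡∂ 4) ∞ V]
    (k : ℕ) (_ : HasHandleDecomposition 3 V (handleCount 1 k)) (_ : IsOrientable (𝓡∂ 4) V)
    (bV : BoundaryData (𝓡∂ 4) V (𝓡 3))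
    (Y : Type) [TopologicalSpace Y] [T2Space Y] [SecondCountableTopology Y]
    [ChartedSpace (EuclideanSpace ℝ (Fin 3)) Y] [IsManifold (𝓡 3) ∞ Y]
    (_ : Nonempty (Y ≃ₘ⟮𝓡 3, 𝓡 3⟯ bV.carrier))
    -- the first genus-`k` Heegaard splitting `Y = H₁ ∪_f H₂`, pieces embedded by `j₁`, `j₂`
    (H₁ : Type) [TopologicalSpace H₁] [ChartedSpace (EuclideanHalfSpace 3) H₁]
    [IsManifold (𝓡∂ 3) ∞ H₁]
    (H₂ : Type) [TopologicalSpace H₂] [ChartedSpace (EuclideanHalfSpace 3) H₂]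
    [IsManifold (𝓡∂ 3) ∞ H₂]
    (b₁ : BoundaryData (𝓡∂ 3) H₁ (𝓡 2)) (b₂ : BoundaryData (𝓡∂ 3) H₂ (𝓡 2))
    (f : b₁.carrier ≃ₘ⟮𝓡 2, 𝓡 2⟯ b₂.carrier) (j₁ : H₁ → Y) (j₂ : H₂ → Y)
    (_ : IsHandlebody k H₁) (_ : IsHandlebody k H₂) (_ : IsBoundaryGluingWith b₁ b₂ f (𝓡 3) j₁ j₂)
    -- the second genus-`k` Heegaard splitting `Y = H₁' ∪_{f'} H₂'`, pieces embedded by `j₁'`, `j₂'`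
    (H₁' : Type) [TopologicalSpace H₁'] [ChartedSpace (EuclideanHalfSpace 3) H₁']
    [IsManifold (𝓡∂ 3) ∞ H₁']
    (H₂' : Type) [TopologicalSpace H₂'] [ChartedSpace (EuclideanHalfSpace 3) H₂']
    [IsManifold (𝓡∂ 3) ∞ H₂']
    (b₁' : BoundaryData (𝓡∂ 3) H₁' (𝓡 2)) (b₂' : BoundaryData (𝓡∂ 3) H₂' (𝓡 2))
    (f' : b₁'.carrier ≃ₘ⟮𝓡 2, 𝓡 2⟯ b₂'.carrier) (j₁' : H₁' → Y) (j₂' : H₂' → Y)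
    (_ : IsHandlebody k H₁') (_ : IsHandlebody k H₂')
    (_ : IsBoundaryGluingWith b₁' b₂' f' (𝓡 3) j₁' j₂'),
    ∃ Φ : Y ≃ₘ⟮𝓡 3, 𝓡 3⟯ Y, Diffeomorph.IsDiffeotopicToId Φ ∧
      ((∃ (ψ₁ : H₁ ≃ₘ⟮𝓡∂ 3, 𝓡∂ 3⟯ H₁') (ψ₂ : H₂ ≃ₘ⟮𝓡∂ 3, 𝓡∂ 3⟯ H₂'),
          ⇑Φ ∘ j₁ = j₁' ∘ ⇑ψ₁ ∧ ⇑Φ ∘ j₂ = j₂' ∘ ⇑ψ₂) ∨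
        (∃ (χ₁ : H₁ ≃ₘ⟮𝓡∂ 3, 𝓡∂ 3⟯ H₂') (χ₂ : H₂ ≃ₘ⟮𝓡∂ 3, 𝓡∂ 3⟯ H₁'),
          ⇑Φ ∘ j₁ = j₂' ∘ ⇑χ₁ ∧ ⇑Φ ∘ j₂ = j₁' ∘ ⇑χ₂))

/-- **(S2, internal target of `stub_productModel`) `π₀ Diff(H_g rel ∂) = 0`** (Moussard Lemma 2.4:
a self-diffeomorphism of a genus-`g` handlebody which is the identity on the boundary is isotopic
to the identity relative to the boundary; proof: a defining disc system and its image agree on the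
boundary hence are isotopic rel `∂` by an innermost-disc argument in the irreducible `H`
(Lemma 2.3, Alexander), Smale's `π₀ Diff(D² rel ∂) = 0`, then Cerf's `π₀ Diff(D³ rel ∂) = 0` —
the tree's leaf `cerf_pi0DiffDisc_relBoundary_three`, which is the case `g = 0`).  Recorded as a
named `Prop` because it is the natural first `--supports` lemma of `stub_productModel`; it is not a
registered stub (stub budget). -/
def HandlebodyRelBoundaryTrivial : Prop :=
  ∀ (g : ℕ) (H : Type) [TopologicalSpace H] [T2Space H] [SecondCountableTopology H]
    [ChartedSpace (EuclideanHalfSpace 3) H] [IsManifold (𝓡∂ 3) ∞ H] (_ : IsHandlebody g H)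
    (b : BoundaryData (𝓡∂ 3) H (𝓡 2)) (ψ : H ≃ₘ⟮𝓡∂ 3, 𝓡∂ 3⟯ H),
    (∀ z : b.carrier, ψ (b.incl z) = b.incl z) →
      ∃ D : Diffeotopy (𝓡∂ 3) H, D.stage 1 = ψ ∧
        ∀ (t : ℝ) (z : b.carrier), D.toFun t (b.incl z) = b.incl z

/-- **(S3) The product model `Z_k = H_k ×_lens I`** (Moussard Thm 2.5, first and last paragraph
of the proof).  For every `k` SOME compact connected orientable smooth `4`-manifold with boundary
`Z` with one `0`-handle and `k` `1`-handles (hence, by the discharged NORM + UNIQ₄, a model of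
EVERY compact connected orientable `4`-dimensional `1`-handlebody with `k` `1`-handles) carries a
boundary datum `bZ` and a genus-`k` Heegaard splitting `∂Z = H₀ ∪_f H₁` (pieces embedded by
`j₀`, `j₁`) such that
(i) **product extension**: every self-diffeomorphism `φ` of `∂Z` preserving the two handlebodies
(`φ ∘ j₀ = j₀ ∘ ψ₀`, `φ ∘ j₁ = j₁ ∘ ψ₁`) extends over `Z` — in the model `Z = H × I /(∂H × I
collapsed along I)`, `∂Z = H × {0} ∪_Σ H × {1}`, the two restrictions agree on `Σ = ∂H`, so
`ψ₁⁻¹ψ₀` is the identity on `∂H`, isotopic to the identity rel `∂H`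
(`HandlebodyRelBoundaryTrivial`, from Cerf's leaf — the hypothesis), and `(x, t) ↦ (ψ_t x, t)`
is the extension;
(ii) **extendable flip**: some self-diffeomorphism `r` of `∂Z` exchanging the two handlebodies
extends over `Z` (the reflection `(x, t) ↦ (x, 1 - t)` of the model).
Design: existential "one model per `k`" exactly as the tree's LEMMA2ᴹ / THMAᴹ / SYMMᴹ model facts
(`SPC4HandlesModelReduction.lean`), transported to every `V` in `stub_laudenbachPoenaru_of`. -/
def ProductModel (k : ℕ) : Prop :=
  ∃ (Z : Type) (_ : TopologicalSpace Z) (_ : T2Space Z) (_ : SecondCountableTopology Z)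
    (_ : CompactSpace Z) (_ : ConnectedSpace Z) (_ : ChartedSpace (EuclideanHalfSpace 4) Z)
    (_ : IsManifold (𝓡∂ 4) ∞ Z) (_ : HasHandleDecomposition 3 Z (handleCount 1 k))
    (_ : IsOrientable (𝓡∂ 4) Z) (bZ : BoundaryData (𝓡∂ 4) Z (𝓡 3))
    (H₀ : Type) (_ : TopologicalSpace H₀) (_ : ChartedSpace (EuclideanHalfSpace 3) H₀)
    (_ : IsManifold (𝓡∂ 3) ∞ H₀)
    (H₁ : Type) (_ : TopologicalSpace H₁) (_ : ChartedSpace (EuclideanHalfSpace 3) H₁)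
    (_ : IsManifold (𝓡∂ 3) ∞ H₁)
    (b₀ : BoundaryData (𝓡∂ 3) H₀ (𝓡 2)) (b₁ : BoundaryData (𝓡∂ 3) H₁ (𝓡 2))
    (f : b₀.carrier ≃ₘ⟮𝓡 2, 𝓡 2⟯ b₁.carrier) (j₀ : H₀ → bZ.carrier) (j₁ : H₁ → bZ.carrier),
    IsHandlebody k H₀ ∧ IsHandlebody k H₁ ∧ IsBoundaryGluingWith b₀ b₁ f (𝓡 3) j₀ j₁ ∧
    -- (i) splitting-preserving self-diffeomorphisms of `∂Z` extend over `Z`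
    (∀ (φ : bZ.carrier ≃ₘ⟮𝓡 3, 𝓡 3⟯ bZ.carrier) (ψ₀ : H₀ ≃ₘ⟮𝓡∂ 3, 𝓡∂ 3⟯ H₀)
        (ψ₁ : H₁ ≃ₘ⟮𝓡∂ 3, 𝓡∂ 3⟯ H₁),
        ⇑φ ∘ j₀ = j₀ ∘ ⇑ψ₀ → ⇑φ ∘ j₁ = j₁ ∘ ⇑ψ₁ → bZ.DiffeoExtends φ) ∧
    -- (ii) an extendable flip exchanging the two handlebodies
    (∃ (r : bZ.carrier ≃ₘ⟮𝓡 3, 𝓡 3⟯ bZ.carrier) (ρ₀ : H₀ ≃ₘ⟮𝓡∂ 3, 𝓡∂ 3⟯ H₁)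
        (ρ₁ : H₁ ≃ₘ⟮𝓡∂ 3, 𝓡∂ 3⟯ H₀),
        ⇑r ∘ j₀ = j₁ ∘ ⇑ρ₀ ∧ ⇑r ∘ j₁ = j₀ ∘ ⇑ρ₁ ∧ bZ.DiffeoExtends r)

/-- **(S5) Dehn–Nielsen–Baer, based smooth form, on boundaries of handlebodies** (= on every closed
orientable surface of genus `g`): every automorphism of `π₁(∂H, x₀)` is induced by a based
self-DIFFEOMORPHISM of `∂H` (Dehn–Nielsen: `Out π₁Σ_g ≅ Mod±(Σ_g)`, Baer/Epstein for
injectivity — not needed here —, inner automorphisms by point-pushes; `g = 0` trivial, `g = 1`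
`Aut ℤ² = GL₂(ℤ)` linear; combinatorial proof: Zieschang–Vogt–Coldewey LNM 835 Thm 5.6.2;
Farb–Margalit, *Primer*, Thm 8.1 and §8.3; smooth category so that no "homeomorphism isotopic to
a diffeomorphism" leaf is imported on the way to `X ≃ₘ X'`, triage r1-2 sharpen (2)).  Necessary
for every line of this crux (NecessityNotesIdeator2 §2) and absent from the tree. -/
def DehnNielsenBaer : Prop :=
  ∀ (g : ℕ) (H : Type) [TopologicalSpace H] [T2Space H] [SecondCountableTopology H]
    [ChartedSpace (EuclideanHalfSpace 3) H] [IsManifold (𝓡∂ 3) ∞ H] (_ : IsHandlebody g H)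
    (b : BoundaryData (𝓡∂ 3) H (𝓡 2)) (x₀ : b.carrier)
    (α : FundamentalGroup b.carrier x₀ ≃* FundamentalGroup b.carrier x₀),
    ∃ (φ : b.carrier ≃ₘ⟮𝓡 2, 𝓡 2⟯ b.carrier) (hφ : φ x₀ = x₀),
      ∀ γ : FundamentalGroup b.carrier x₀,
        FundamentalGroup.mapOfEq (⟨φ, φ.continuous⟩ : C(b.carrier, b.carrier)) hφ γ = α γ

/-! ## Registered stubs (the ONLY `sorry`s of the file) -/

/-- **stub 1 (rank: hardest, XL; Moussard Thm 2.1 = Thm 3.14 at `P = ∅`, Carvalho–Oertel 2005;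
3-manifold topology).**  Isotopy-uniqueness of the genus-`k` Heegaard splitting of `#ᵏ(S¹ × S²)`.
Printed proof: induction on `k`; for `k > 0` the sutured strong Haken theorem (Thm 3.10, after
Hensel–Schultens arXiv:2102.09831 / Scharlemann arXiv:2003.08523) gives a non-separating Haken
sphere (meets the Heegaard surface in ONE circle); cut along it, add the circle to the suture,
genus drops by one; base: genus-`0` splittings of punctured `S³` (Prop 3.13 / HS24 Thm 3.3,
Alexander).  Why plausibly true: published theorem (two independent proofs).  Size: XL (needs
sutured / relative Heegaard vocabulary as internal `--supports` lemmas; no new definition is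
REQUIRED to state the stub).  Leans on: `IsHandlebody`, `IsBoundaryGluingWith`,
`Diffeomorph.IsDiffeotopicToId`, `Diffeotopy`, `SphereEmbedding.schoenflies_exists_ball`
(Alexander, named fact, for the base and irreducibility), `exists_diffeotopy_of_boundaryless`. -/
theorem stub_minimalSplittingIsotopy : MinimalHeegaardIsotopy := by
  sorry

/-- **stub 2 (L; Moussard Thm 2.5 ¶1 + Lemmas 2.3–2.4; 3- and 4-manifold topology).**  From Cerf's
`π₀ Diff(D³ rel ∂) = 0` (the hypothesis, used HERE and only here), the product model exists for
every `k`: build `Z_k` as the rounded lens product of a genus-`k` handlebody `H` (e.g. a thickened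
planar handlebody, cf. `ThickenedPlanarHandlebody.lean` one dimension lower) with `I`; its Morse
function `= (Morse function of H with one 0-handle, k 1-handles) + (height)²` has one `0`-handle
and `k` `1`-handles (`HasHandleDecomposition 3 Z (handleCount 1 k)`); `∂Z = H × 0 ∪_{∂H} H × 1`
is a genus-`k` Heegaard splitting; (i) via `HandlebodyRelBoundaryTrivial` (first `--supports`
lemma: Lemma 2.3 innermost discs + Smale `D²` + the hypothesis) and the product formula with `ψ_t`
made constant near `t = 0, 1` and near `∂H`; (ii) the reflection `t ↦ 1 - t`.  Why plausibly
true: (i) and (ii) are instances of LP, a theorem; the model proof is ten lines in print.  Size: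
L (smooth structure of the lens product near `Σ`; `cornerFold`-type rounding as in
`Trisections.lean`; cheapest check `k = 0`: `B⁴` as rounded `B³ × I`, boundary two hemispheres —
essentially `sphere_genusZero_gkTrisection_holds`).  Leans on: `Diffeotopy`, `BoundaryData`,
`IsHandlebody`, `HasHandleDecomposition`, collar API (`CollarTheorem.lean`). -/
theorem stub_productModel : cerf_pi0DiffDisc_relBoundary_three → ∀ k : ℕ, ProductModel k := by
  sorry

/-- **stub 3 (M/L; Moussard Thm 2.5 ¶2–3 + the tree's model transport; 4-manifold bookkeeping
with one idea).**  LP for every `V` from isotopy-uniqueness and the product models: given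
`φ : ∂V ≅ ∂V`, NORM (`exists_hasHandleDecomposition_handleCount_one_holds`) gives `k`, UNIQ₄
(`nonempty_diffeomorph_of_hasHandleDecomposition_handleCount_one_holds`) a diffeomorphism
`e : V ≅ Z_k`, and `BoundaryData.restrictDiffeomorph` / `BoundaryData.DiffeoExtends.conj`
(`SPC4HandlesModelReduction.lean`) reduce to `bZ.DiffeoExtends φ₀`.  On the model: `φ₀` carries
the model splitting `(j₀, j₁)` to the genus-`k` splitting `(φ₀ ∘ j₀, φ₀ ∘ j₁)`
(`IsBoundaryGluingWith.diffeomorph_comp`); `MinimalHeegaardIsotopy` (with `V := Z`, `Y := ∂Z`)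
gives `Φ` diffeotopic to `id` with `Φ ∘ φ₀` splitting-preserving or side-swapping; `Φ` extends by
the PROVED collar fact `BoundaryData.diffeoExtends_of_isDiffeotopicToId_holds`; in the preserving
case `φ₀.trans Φ` extends by (i), in the swapping case `(φ₀.trans Φ).trans r` does and `r`
extends by (ii); close with `DiffeoExtends.trans/.symm`.  Why plausibly true: it is Moussard's
proof verbatim plus discharged tree facts.  Size: M (L with the boundary-datum transport).
Leans on (all PROVED): NORM, UNIQ₄, collar fact, `DiffeoExtends.trans/symm/conj`,
`IsBoundaryGluingWith.diffeomorph_comp`. -/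
theorem stub_laudenbachPoenaru_of :
    MinimalHeegaardIsotopy → (∀ k : ℕ, ProductModel k) → exists_diffeomorph_comp_incl_eq.{0} := by
  sorry

/-- **stub 4 (L; Dehn–Nielsen–Baer; surface topology / combinatorial group theory).**  See
`DehnNielsenBaer`.  Why plausibly true: classical theorem (Dehn 1922, Nielsen 1927, Baer 1928).
Size: L (plan A: ZVC Thm 5.6.2 realisation of automorphisms by homeomorphisms of the model
surface, smoothed; plan B: generate `Aut π₁` by images of Dehn twists — Lickorish twists exist in
the tree, `LickorishTwistSurgery.lean` — plus McCool/Nielsen peak reduction over the PROVED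
`autFreeGroup_eq_closure_nielsen_holds`).  Leans on: `FundamentalGroup.mapOfEq` (Mathlib),
`BoundaryData`, `IsHandlebody`; shared with lines lp-by-sphere-system-surgery /
level-set-kirby-triple / binary-product-nielsen (their DNB stubs). -/
theorem stub_dehnNielsenBaer : DehnNielsenBaer := by
  sorry

/-- **stub 5 (XL; Abrams–Gay–Kirby 2018 Thm 5, rigidity half (b′) = "a trisection (diagram)
determines the 4-manifold"; shared verbatim with line lp-by-sphere-system-surgery).**  From DNB
and LP: given balanced GK-trisections of `X`, `X'` with `Iso`-morphic kernel triples, (1) DNB on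
`F' ≅ ∂H` turns `μ' ∘ α ∘ μ⁻¹ : π₁(F, x₀) ≅ π₁(F', x₀')` into a based diffeomorphism `F → F'`
carrying each handlebody kernel `ker(π₁F → π₁H_ij)` to its counterpart; (2) handlebody extension
(disc lemma: a boundary diffeomorphism of genus-`g` handlebodies respecting meridian kernels
extends — Dehn's lemma for handlebodies / complete disc systems) extends it over the three
`H_ij`; (3) regular neighbourhoods of the spines `⋃ H_ij` are diffeomorphic (corner charts of
`IsGKTrisection`, `cornerFold`); (4) the three sector complements are `4`-dimensional
`1`-handlebodies with identified boundaries — LP (the hypothesis, ×3, with UNIQ₄) extends, and the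
pieces glue to `X ≃ₘ X'`.  Why plausibly true: published theorem (AGK Thm 5; folklore since
Gay–Kirby 2016 §2).  Size: XL (steps (2)–(3) are the bulk; LP and DNB enter as hypotheses).
Leans on: `IsBalancedGKTrisection`, `groupGKTrisectionOf`, `centralSurface`, `TrisectionKernels.Iso`,
corner technology of `Trisections.lean`, gluing (`Gluing.lean`, `IsBoundaryGluingWith`), UNIQ₄. -/
theorem stub_rigidity_of_lp :
    DehnNielsenBaer → exists_diffeomorph_comp_incl_eq.{0} →
      diffeomorph_of_iso_groupGKTrisectionOf.{0} := by
  sorry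

/-- **stub 6 (DELEGATED leaf; Cerf 1968 Ch. I §2 (2) / Hatcher 1983: `π₀ Diff(D³ rel ∂) = 0`).**
The tree's named fact `cerf_pi0DiffDisc_relBoundary_three` (`CerfPropositionFour.lean`), the single
leaf isolated by the barrier file `TwistedSpheresStandard`; consumed by `stub_productModel` only.
Not this line's work: it is the fact seat `provefact-…cerf_pi0DiffDisc_relBoundary_three`
(blocked-on for the lead; every line of this crux needs it or `Γ₄ = 0`).  Why plausibly true:
Cerf's theorem.  Size: XL (Cerf Chapters II–VI / Hatcher's Smale conjecture). -/
theorem stub_cerfDiscRelBoundary : cerf_pi0DiffDisc_relBoundary_three := by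
  sorry

/-- **stub 7 (DELEGATED leaf; Abrams–Gay–Kirby Thm 5 / Gay–Kirby Lemma 10: stabilisation
compatibility (c′)).**  The tree's named fact `exists_stabilized_gkTrisection` at universe `0`,
in flight elsewhere (`IsGKTrisection.exists_stabilization`, `TriNormalForm.exists_stabilization`
and the on-the-nose `π₁` stage `exists_marking_groupGKTrisectionOf_eq_stabilizeOne_datum` are
PROVED; the joint-chart-datum implant step and the Nielsen lift remain).  Not this line's work.
If the Nielsen-free pair (d′) `sphere_gkTrisections` + (G) "one stabilisable marking" lands first,
the lead re-derives the crux by `spc4_of_forall_isStablyTrivial_of_stabilizableMarking` instead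
(same (b′) input; `Probe.crux_of_rigidity_spheres_oneMarking` of triage r1-1).  Why plausibly
true: published theorem.  Size: XL. -/
theorem stub_agkStabilisation : exists_stabilized_gkTrisection.{0} := by
  sorry

/-! ## Name-keyed aliases of the seven stub statements (the hypotheses of the composition)

`__Registered.stub_X` is the statement of `stub_X` under the registered stub's short name, so that the native
skeleton audit (`#h21_check_skeleton`: hypotheses admissible iff registered obligations / declared stubs BY
NAME) accepts `AgkCor6Sufficiency_of : __Registered.stub_… → … → AgkCor6Sufficiency` (device of
`CriticalPhenomena/…/Lines/br-sandwich-diagonal.lean`; the namespace is an implementation detail, and the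
audit's stub report resolves each `stub_…` to the sorried theorem, not to its alias; the audit's `@[stub]`
attribute is gate-reserved and not written by a planner).  `agkCor6Sufficiency_proof` applies the
composition to the seven `stub_…` literally, which checks that statements, aliases and stubs agree. -/
namespace __Registered

/-- Alias of the statement of `stub_minimalSplittingIsotopy`. -/
abbrev stub_minimalSplittingIsotopy : Prop := MinimalHeegaardIsotopy
/-- Alias of the statement of `stub_productModel`. -/
abbrev stub_productModel : Prop := cerf_pi0DiffDisc_relBoundary_three → ∀ k : ℕ, ProductModel k
/-- Alias of the statement of `stub_laudenbachPoenaru_of`. -/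
abbrev stub_laudenbachPoenaru_of : Prop :=
  MinimalHeegaardIsotopy → (∀ k : ℕ, ProductModel k) → exists_diffeomorph_comp_incl_eq.{0}
/-- Alias of the statement of `stub_dehnNielsenBaer`. -/
abbrev stub_dehnNielsenBaer : Prop := DehnNielsenBaer
/-- Alias of the statement of `stub_rigidity_of_lp`. -/
abbrev stub_rigidity_of_lp : Prop :=
  DehnNielsenBaer → exists_diffeomorph_comp_incl_eq.{0} → diffeomorph_of_iso_groupGKTrisectionOf.{0}
/-- Alias of the statement of `stub_cerfDiscRelBoundary`. -/
abbrev stub_cerfDiscRelBoundary : Prop := cerf_pi0DiffDisc_relBoundary_three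
/-- Alias of the statement of `stub_agkStabilisation`. -/
abbrev stub_agkStabilisation : Prop := exists_stabilized_gkTrisection.{0}

end __Registered

/-! ## The kernel-checked composition -/

/-- **The line closes the crux (decl of route `GroupTrisection`, the item's first route; the skeleton
audit's default crux decl).**  From the seven stub statements, in order: isotopy-uniqueness (stub 1)
and the product models (stub 2, fed by Cerf's leaf, stub 6) give Laudenbach–Poénaru (stub 3); LP and
Dehn–Nielsen–Baer (stub 4) give AGK's rigidity leaf (b′) (stub 5); (b′), (c′) (stub 7) and the PROVED
Gay–Kirby Thm 4 `exists_isBalancedGKTrisection_holds` give AGK Cor. 6 ⇐, i.e. the crux, by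
`spc4_of_forall_isStablyTrivial_of_three_leaves` — the hypothesis `X` of the crux is used once, as
`hst`.  No `sorry`; axioms of this theorem: propext, Classical.choice, Quot.sound. -/
theorem AgkCor6Sufficiency_of (hIso : __Registered.stub_minimalSplittingIsotopy)
    (hModel : __Registered.stub_productModel) (hLP : __Registered.stub_laudenbachPoenaru_of)
    (hDNB : __Registered.stub_dehnNielsenBaer) (hRig : __Registered.stub_rigidity_of_lp)
    (hCerf : __Registered.stub_cerfDiscRelBoundary) (hc : __Registered.stub_agkStabilisation) :
    Summit.SmoothPoincare4.SmoothPoincare4.Theses.GroupTrisection.AgkCor6Sufficiency := by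
  intro hst M _ _ _
  exact spc4_of_forall_isStablyTrivial_of_three_leaves exists_isBalancedGKTrisection_holds
    (hRig hDNB (hLP hIso (hModel hCerf))) hc hst M

/-- **The same composition concluding the decl of route `CongruenceShadows`** (payload `route_id`; the
crux is `wanted_by` both routes with identical bodies, so one term serves both names). -/
theorem AgkCor6Sufficiency_of_congruenceShadows (hIso : __Registered.stub_minimalSplittingIsotopy)
    (hModel : __Registered.stub_productModel) (hLP : __Registered.stub_laudenbachPoenaru_of)
    (hDNB : __Registered.stub_dehnNielsenBaer) (hRig : __Registered.stub_rigidity_of_lp)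
    (hCerf : __Registered.stub_cerfDiscRelBoundary) (hc : __Registered.stub_agkStabilisation) :
    Summit.SmoothPoincare4.SmoothPoincare4.Theses.CongruenceShadows.AgkCor6Sufficiency :=
  AgkCor6Sufficiency_of hIso hModel hLP hDNB hRig hCerf hc

/-- The composition fed with the registered stubs literally (checks that statements, aliases and
stubs agree; `#print axioms` = the standard three + `sorryAx` from the seven stubs only). -/
theorem agkCor6Sufficiency_proof :
    Summit.SmoothPoincare4.SmoothPoincare4.Theses.GroupTrisection.AgkCor6Sufficiency :=
  AgkCor6Sufficiency_of stub_minimalSplittingIsotopy stub_productModel stub_laudenbachPoenaru_of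
    stub_dehnNielsenBaer stub_rigidity_of_lp stub_cerfDiscRelBoundary stub_agkStabilisation

/-- Idem for route `CongruenceShadows`. -/
theorem agkCor6Sufficiency_proof_congruenceShadows :
    Summit.SmoothPoincare4.SmoothPoincare4.Theses.CongruenceShadows.AgkCor6Sufficiency :=
  AgkCor6Sufficiency_of_congruenceShadows stub_minimalSplittingIsotopy stub_productModel
    stub_laudenbachPoenaru_of stub_dehnNielsenBaer stub_rigidity_of_lp stub_cerfDiscRelBoundary
    stub_agkStabilisation

/-- Unfolded form over the plain statements (the item's signature verbatim, no aliases), for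
readers without either route file; not a skeleton candidate (its conclusion is not a name). -/
theorem agkCor6Sufficiency_of_statements :
    MinimalHeegaardIsotopy →
    (cerf_pi0DiffDisc_relBoundary_three → ∀ k : ℕ, ProductModel k) →
    (MinimalHeegaardIsotopy → (∀ k : ℕ, ProductModel k) → exists_diffeomorph_comp_incl_eq.{0}) →
    DehnNielsenBaer →
    (DehnNielsenBaer → exists_diffeomorph_comp_incl_eq.{0} →
      diffeomorph_of_iso_groupGKTrisectionOf.{0}) →
    cerf_pi0DiffDisc_relBoundary_three →
    exists_stabilized_gkTrisection.{0} →
    ((∀ (k : ℕ) (K : TrisectionKernels (3 * k)),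
        IsGroupTrisection (3 * k) k (PUnit : Type) K → K.IsStablyTrivial) →
      ∀ (M : Type) [TopologicalSpace M] [T2Space M] [SecondCountableTopology M],
        ContinuousMap.HomotopyEquiv.NonemptyDiffeomorphSphere M 4) :=
  AgkCor6Sufficiency_of

end Summit.SmoothPoincare4.SmoothPoincare4.Cruxes.AgkCor6Sufficiency.LpByMinimalHeegaardSplitting

end
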